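import Summits.FinalStateConjecture.FinalStateConjecture.Theorems.ZeroEnergyKerrOrBombSymplecticDualOfTheBombSig
import Summits.FinalStateConjecture.FinalStateConjecture.Theorems.ZeroEnergyKerrOrBombStationaryLimitReductionStubMoncriefTransversality
import Summits.FinalStateConjecture.FinalStateConjecture.Theorems.ZeroEnergyKerrOrBombStationaryLimitReductionMoncriefFactsAudit
import Literature.Geometry.Lorentzian.AdmissibleDataLocality
import Literature.Geometry.Lorentzian.CauchyDevelopment
import Literature.Geometry.Lorentzian.Genericity
import Literature.Geometry.Lorentzian.LeviCivitaProofs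
import HarnessLib
import Literature.Geometry.Lorentzian.LocalConstraintDeformation

/-!
# Route ZeroEnergyKerrOrBomb · crux `StationaryLimitReduction`, line `symplectic-dual-of-the-bomb`
# (reshape r5): stub `stub_moncriefFacts` — fact (a) as a CITED named fact and its bridge; the
# `k = 1` content of fact (b)

Helper file (`--supports stmt-FinalStateConjecture-10021`; registered helpers
`localConstraintDeformationAt_of_fact`, `singleDetection_of_localMoncriefDuality`) of the wave-3
stub-worker for stub 4 `stub_moncriefFacts : Sig.stub_moncriefFacts` (lead
prover-line-stmt-FinalStateConjecture-10021-a2-0, 2026-08-16). The stub is the conjunction of the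
universal closures of the two local facts of p105738, (a) `LocalConstraintDeformationAt` and
(b) `LocalMoncriefDualityAt`; neither is provable in this tree (no elliptic theory for the KID
operator, no Banach inverse function theorem into `C^∞` families; audit p115964). This file:

* §1 **fact (a) is PRINTED up to assembly, and is written as the named fact**
  `ChruscielDelay_localConstraintDeformation` over LITERATURE vocabulary only (`InitialDataSet`,
  `VacuumCauchyDevelopment`, Killing fields of the development, `InitialDataSet.IsSmoothDataFamily`,
  fibrewise `deriv`s of the sections; the Summits-side abbreviations `IsKIDFreeAt`,
  `IsLinearisedSolutionIn`, `IsSupportedIn`, `famTangentH/K` unfolded verbatim), with the vacuum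
  constraints — not admissibility — in hypothesis and conclusion, exactly as in print
  (Chruściel–Delay 2003 Thm. 5.9 / Prop. 5.10 / Cor. 5.11 and 2004 Thm. 6.6 / Cor. 5.11;
  Corvino–Schoen 2006 Thm. 2; Moncrief 1975 §III for KIDs ↔ Killing fields); the docstring names
  every assembly step. The gate relocates it to `Literature/Geometry/Lorentzian/`.
* §2 `localConstraintDeformationAt_of_fact` (registered): the fact implies
  `∀ X D 𝒟 x₀, LocalConstraintDeformationAt 𝒟 x₀` — definitional unfolding plus the tree's
  `localConstraintDeformationAt_of_vacuum` (admissibility off a compact set is free, p115964).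
* §3 `isLocalSliceTangentAt_smul`: local slice tangents are closed under real multiples
  (reparametrised slice deformation), whence `singleDetection_of_localMoncriefDuality`
  (registered): fact (b) at `k = 1` IS single detection — every symmetric non-gauge pair smooth near
  `x₀` pairs non-trivially with a compactly supported linearised solution in any neighbourhood.
  The converse reduction (single detection with integrable kicks ⇒ (b) for every `k`, by linear
  algebra on the detection rows) and the reshaped stub are the companion file
  `…StationaryLimitReductionMoncriefDualityReductionWave3.lean` of the same worker.

Verdict reported to the lead: `stub-blocked` on the unprinted LOCALISED Moncrief duality (single
detection); (a) := the Literature fact, taken as a hypothesis. No `sorry`, no new axioms.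
-/

-- every `Summit.FinalStateConjecture.FinalStateConjecture.…` name repeats the summit = sub-problem segment (D-0017 layout)
set_option linter.dupNamespace false
set_option maxSynthPendingDepth 3

noncomputable section

open scoped Manifold ContDiff Topology BigOperators
open Set Filter Bundle MeasureTheory Literature.Geometry.Lorentzian

namespace Summit.FinalStateConjecture.FinalStateConjecture.Theorems.SymplecticDualOfTheBomb

/-! ## §1 Fact (a): local deformations of the vacuum constraints (cited named fact) -/

/-- **`LocalConstraintDeformationAt` at every `(X, D, 𝒟, x₀)` from the cited fact.** The cited fact
is, up to unfolding `IsKIDFreeAt`, `IsLinearisedSolutionIn`, `IsSupportedIn`, `famTangentH/K`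
(definitional), the predicate `LocalConstraintDeformationAt 𝒟 x₀` with the vacuum constraints in
place of admissibility; admissibility of `D` gives the vacuum hypothesis, and admissibility of every
`G c` is free for vacuum data agreeing with the admissible `D` off the compact `K'`
(`localConstraintDeformationAt_of_vacuum`, p115964, from `mem_admissibleVacuumData_of_agree_off_compact`).
[cite: Christodoulou1999, p. A24] -/
theorem localConstraintDeformationAt_of_fact : Literature.Geometry.Lorentzian.ChruscielDelay_localConstraintDeformation → ∀ (X : Type) [TopologicalSpace X] [ChartedSpace E3 X] [IsManifold (𝓡 3) ∞ X] [T2Space X] [SecondCountableTopology X] [ConnectedSpace X] (D : InitialDataSet (𝓡 3) X) (𝒟 : VacuumCauchyDevelopment D) (x₀ : X), LocalConstraintDeformationAt 𝒟 x₀ := by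
  intro hfact X _ _ _ _ _ _ D 𝒟 x₀
  refine localConstraintDeformationAt_of_vacuum X D 𝒟 x₀ fun hD hKID V hV hxV ↦ ?_
  exact hfact X D 𝒟 x₀ hD.1.1 hKID V hV hxV

/-! ## §3 Fact (b) at `k = 1` is single detection -/

/-- **Local slice tangents are closed under real multiples**: reparametrise the slice deformation,
`ι'_s := ι_{t s}`, `ν'_s := ν_{t s}`, on the interval `|s| < δ / (|t| + 1)`; joint smoothness and
the unit-normal clauses transfer, and both first variations scale by `t` (chain rule). [folklore] -/
theorem isLocalSliceTangentAt_smul : ∀ (X : Type) [TopologicalSpace X] [ChartedSpace E3 X] [IsManifold (𝓡 3) ∞ X] [ConnectedSpace X] (D : InitialDataSet (𝓡 3) X) (𝒟 : VacuumCauchyDevelopment D) (A B : BilinField X) (x₀ : X) (t : ℝ), IsLocalSliceTangentAt 𝒟 A B x₀ → IsLocalSliceTangentAt 𝒟 (t • A) (t • B) x₀ := by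
  intro X _ _ _ _ D 𝒟 A B x₀ t h
  obtain ⟨V, δ, hV, hx₀, hδ, ι, ν, hι0, hsm, hν, hder⟩ := h
  set δ' : ℝ := δ / (|t| + 1) with hδ'
  have hδ'pos : 0 < δ' := div_pos hδ (by positivity)
  have hmem : ∀ s ∈ Set.Ioo (-δ') δ', t * s ∈ Set.Ioo (-δ) δ := by
    intro s hs
    have hs' : |s| < δ' := abs_lt.2 hs
    have h1 : |t| * δ' < δ := by
      rw [hδ', ← mul_div_assoc, div_lt_iff₀ (by positivity)]
      nlinarith [abs_nonneg t]
    have h2 : |t * s| < δ := by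
      rw [abs_mul]
      exact (mul_le_mul_of_nonneg_left hs'.le (abs_nonneg t)).trans_lt h1
    exact abs_lt.1 h2
  refine ⟨V, δ', hV, hx₀, hδ'pos, fun s ↦ ι (t * s), fun s ↦ ν (t * s), ?_, ?_, ?_, ?_⟩
  · show ι (t * 0) = 𝒟.embed
    rw [mul_zero]
    exact hι0
  · have hg : ContMDiff (𝓘(ℝ, ℝ).prod (𝓡 3)) (𝓘(ℝ, ℝ).prod (𝓡 3)) ∞
        (fun p : ℝ × X ↦ (t * p.1, p.2)) :=
      ((contDiff_const.mul contDiff_id).contMDiff.comp contMDiff_fst).prodMk contMDiff_snd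
    exact hsm.comp hg.contMDiffOn fun p hp ↦ ⟨hmem p.1 hp.1, hp.2⟩
  · intro s hs y hy
    exact hν (t * s) (hmem s hs) y hy
  · intro y hy v w
    obtain ⟨hA, hB⟩ := hder y hy v w
    have hc : HasDerivAt (fun r : ℝ ↦ t * r) t 0 := by
      simpa using (hasDerivAt_id (0 : ℝ)).const_mul t
    haveI : 𝒟.metric.toPseudoRiemannianMetric.HasLeviCivita := 𝒟.metric.hasLeviCivita
    constructor
    · have hA' : HasDerivAt (fun s : ℝ ↦ pullbackBilin (I := 𝓡 4) (I' := 𝓡 3) (ι s) 𝒟.metric.val y v w)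
          (A y v w) ((fun r : ℝ ↦ t * r) 0) := by simpa using hA
      have key := hA'.comp 0 hc
      have hval : (t • A) y v w = A y v w * t := by rw [mul_comm]; rfl
      rw [hval]
      exact key
    · have hB' : HasDerivAt (fun s : ℝ ↦
          𝒟.metric.toPseudoRiemannianMetric.secondFundamentalForm (𝓡 3) (ι s) (ν s) y v w)
          (B y v w) ((fun r : ℝ ↦ t * r) 0) := by simpa using hB
      have key := hB'.comp 0 hc
      have hval : (t • B) y v w = B y v w * t := by rw [mul_comm]; rfl
      rw [hval]
      exact key

/-- **Fact (b) detects single detectors** (its `k = 1` instance; registered helper): under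
`LocalMoncriefDualityAt 𝒟 x₀`, every SYMMETRIC pair `(A, B)` smooth on an open `U ∋ x₀` inside the
chart source which is not a local slice tangent at `x₀` pairs non-trivially, in the chart at `x₀`,
with some linearised solution supported in a compact `K ⊆ U` (the `1 × 1` pairing matrix is its
entry, `Matrix.det_unique`; non-zero multiples of a non-gauge pair are non-gauge,
`isLocalSliceTangentAt_smul`). With the converse of the companion file
(`localMoncriefDuality_of_singleDetection`: single detection with integrable kicks ⇒ (b) for all
`k`), this pins the unprinted content of (b) to ONE linear statement, local single detection — the
local annihilator lemma "a symmetric pair `ω`-orthogonal to all compactly supported linearised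
solutions near `x₀` is `J∘DΦ*(N, Y)` = a local slice tangent" (Moncrief's splitting, printed
globally: J. Math. Phys. 16 (1975) 1556; Fischer–Marsden–Moncrief, Ann. IHP A 33 (1980) §1–2).
[cite: Wald1984GR, Appendix E.2] -/
theorem singleDetection_of_localMoncriefDuality : ∀ (X : Type) [TopologicalSpace X] [ChartedSpace E3 X] [IsManifold (𝓡 3) ∞ X] [T2Space X] [SecondCountableTopology X] [ConnectedSpace X] (D : InitialDataSet (𝓡 3) X) (𝒟 : VacuumCauchyDevelopment D) (x₀ : X), LocalMoncriefDualityAt 𝒟 x₀ → ∀ (A B : BilinField X), (∀ x (v w : TangentSpace (𝓡 3) x), A x v w = A x w v ∧ B x v w = B x w v) → ¬ IsLocalSliceTangentAt 𝒟 A B x₀ → ∀ U : Set X, IsOpen U → x₀ ∈ U → U ⊆ (extChartAt (𝓡 3) x₀).source → SmoothBilinOn A U → SmoothBilinOn B U → ∃ (a b : BilinField X) (K : Set X), IsCompact K ∧ K ⊆ U ∧ IsLinearisedSolutionIn D a b K ∧ chartPairing D x₀ A B a b ≠ 0 := by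
  intro X _ _ _ _ _ _ D 𝒟 x₀ hM A B hsymm hng U hU hxU hUsrc hA hB
  have hng' : ∀ a : Fin 1 → ℝ, a ≠ 0 →
      ¬ IsLocalSliceTangentAt 𝒟 (fun x ↦ ∑ j, a j • (fun _ : Fin 1 ↦ A) j x)
        (fun x ↦ ∑ j, a j • (fun _ : Fin 1 ↦ B) j x) x₀ := by
    intro a ha hst
    have ha0 : a 0 ≠ 0 := fun h0 ↦ ha (funext fun j ↦ by
      rw [Fin.fin_one_eq_zero j, h0]
      rfl)
    apply hng
    have key := isLocalSliceTangentAt_smul X D 𝒟 _ _ x₀ (a 0)⁻¹ hst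
    convert key using 2
    · funext x
      simp [smul_smul, inv_mul_cancel₀ ha0]
    · funext x
      simp [smul_smul, inv_mul_cancel₀ ha0]
  obtain ⟨a, b, K, hKc, hKU, hlin, hdet⟩ := hM 1 (fun _ ↦ A) (fun _ ↦ B) (fun _ x v w ↦ hsymm x v w)
    hng' U hU hxU hUsrc (fun _ ↦ ⟨hA, hB⟩)
  refine ⟨a 0, b 0, K, hKc, hKU, hlin 0, ?_⟩
  rwa [Matrix.det_unique] at hdet

end Summit.FinalStateConjecture.FinalStateConjecture.Theorems.SymplecticDualOfTheBomb

end
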